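import Mathlib
import Summits.Langlands.Langlands.Theorems.QuadraticWindowHostInducedRepPaneDefs
import Summits.Langlands.Langlands.Theorems.QuadraticWindowHostInducedRepPatchDescend
import Summits.Langlands.Langlands.Theorems.HostInducedRep.Negative.AsaiSignHazard
import Literature.NumberTheory.Automorphic.AutomorphicInductionUnitaryCharacterCubicResolventDescent
import Literature.NumberTheory.QuadraticForms.QuadraticExtensionPlaces

/-!
# Sub-stub `stub_memberSatake` of the member statement (stub `stub_package`, line
# `one-transparent-pane`, crux `Summit.Langlands.Langlands.Theses.QuadraticWindow.HostInducedRep`,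
# item stmt-Langlands-10902) — helper file 1: places in the biquadratic pane tower

LOG (wave-3 worker `stub_memberSatake`, 2026-08-16).  FACT-FREE (theorems only).

Setting: the pane tower of `IsPaneTower τ cK L F' s` — `F/F₀` quadratic with involution `τ`,
`K/F₀` quadratic with involution `cK`, `L ⊇ F, K` quadratic over each and over `F'` with
involution `s` (`s|_K = cK`, `s|_F = τ`), `F ∩ K = F₀`.  Proved here (the Galois bookkeeping
consumed by the Satake-level identities `τ' = AI_{L/K}(P)`, `P^s ≅ P^∨` of helper files 3–4):

* §1 (adapted from the asaiPoleInduced worker's `AsaiTowerPlaces.lean`, not in the tree):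
  `Gal(L/F₀) = {1, t₀, s₀, s₀t₀}` from four distinct automorphisms of a degree-`4` extension
  (`paneKlein_card`, `paneKlein_isGalois`), non-cyclicity
  (`paneKlein_not_isCyclic`), and **no place of full residue degree at an unramified place of a
  Galois extension with non-cyclic group** (`paneKlein_inertiaDeg_ne_finrank`: the decomposition
  group would be everything and would embed, inertia being trivial, into the cyclic automorphism
  group of the residue extension);
* §2 the pane automorphisms: `s` as an `F₀`-automorphism, the generator `t` of `Gal(L/K)` acts on
  `F` by `τ` (`exists_paneGen`: an element of `F` fixed by `t` lies in `K`, hence in `F ∩ K = F₀`),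
  and `f(𝔓|v) ≠ 4` above every place `v` of `F₀` unramified in `L` (`pane_inertiaDeg_ne_four`);
* §3 places: `(σ • 𝔓) ∩ 𝓞 F = ρ • (𝔓 ∩ 𝓞 F)` when `σ|_F = ρ` (`under_smul_of_comm`), and
  **a `t`-fixed place of `L` above an unramified `v` splits over `F`** (`pane_inertiaDeg_F_eq_one`:
  `t𝔓 = 𝔓` forces `τ w = w` for `w = 𝔓 ∩ F`, so `f(w|v) = 2`, and `f(𝔓|v) = f(w|v) f(𝔓|w) ≠ 4`).
[folklore]
-/

open IsDedekindDomain NumberField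
open Literature.NumberTheory.Automorphic Literature.NumberTheory.GaloisRepresentations
open Summit.Langlands.Langlands.Theorems.HostInducedRep.GrsExplicitDescent
open Summit.Langlands.Langlands.Theorems.HostInducedRep.Negative

-- `Summit.Langlands.Langlands.…` (summit = sub-problem name, D-0017 layout) trips `dupNamespace`.
set_option linter.dupNamespace false

noncomputable section

namespace Summit.Langlands.Langlands.Theorems.HostInducedRep.OneTransparentPane

/-! ## §1 The Klein group `{1, t₀, s₀, s₀t₀}` and non-cyclic decomposition -/

section Klein

open scoped Pointwise

variable {F L : Type} [Field F] [Field L] [Algebra F L]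

-- adapted from work/stubs/AsaiTowerPlaces.lean (asaiPoleInduced worker; `card_algEquiv_of_four`)
/-- Four pairwise distinct automorphisms of an extension of degree `4`: `#Aut(L/F) = 4`. [folklore] -/
theorem paneKlein_card (h4 : Module.finrank F L = 4) {t₀ s₀ : L ≃ₐ[F] L} (ht : t₀ ≠ 1)
    (hs : s₀ ≠ 1) (hst : s₀ ≠ t₀) (hst1 : s₀ * t₀ ≠ 1) : Nat.card (L ≃ₐ[F] L) = 4 := by
  classical
  haveI : FiniteDimensional F L := Module.finite_of_finrank_eq_succ h4
  have hcard : Fintype.card (L ≃ₐ[F] L) ≤ 4 := h4 ▸ AlgEquiv.card_le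
  have hst' : s₀ * t₀ ≠ t₀ := fun e ↦ hs (mul_eq_right.mp e)
  have hss' : s₀ * t₀ ≠ s₀ := fun e ↦ ht (mul_eq_left.mp e)
  have h4' : ({1, t₀, s₀, s₀ * t₀} : Finset (L ≃ₐ[F] L)).card = 4 := by
    rw [Finset.card_insert_of_notMem, Finset.card_insert_of_notMem, Finset.card_insert_of_notMem,
      Finset.card_singleton]
    · simpa using hss'.symm
    · simp only [Finset.mem_insert, Finset.mem_singleton, not_or]
      exact ⟨hst.symm, hst'.symm⟩
    · simp only [Finset.mem_insert, Finset.mem_singleton, not_or]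
      exact ⟨ht.symm, hs.symm, hst1.symm⟩
  have := Finset.card_le_univ ({1, t₀, s₀, s₀ * t₀} : Finset (L ≃ₐ[F] L))
  rw [Nat.card_eq_fintype_card]
  omega

-- adapted from work/stubs/AsaiTowerPlaces.lean (`isGalois_of_four`)
/-- … hence `L/F` is Galois (`#Aut(L/F) = [L : F]`, Mathlib `IsGalois.of_card_aut_eq_finrank`).
[folklore] -/
theorem paneKlein_isGalois (h4 : Module.finrank F L = 4) {t₀ s₀ : L ≃ₐ[F] L} (ht : t₀ ≠ 1)
    (hs : s₀ ≠ 1) (hst : s₀ ≠ t₀) (hst1 : s₀ * t₀ ≠ 1) : IsGalois F L := by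
  haveI : FiniteDimensional F L := Module.finite_of_finrank_eq_succ h4
  exact IsGalois.of_card_aut_eq_finrank F L ((paneKlein_card h4 ht hs hst hst1).trans h4.symm)

-- adapted from work/stubs/AsaiTowerPlaces.lean (`not_isCyclic_of_four`)
/-- **The Klein group is not cyclic**: `1`, `t₀`, `s₀` are three distinct solutions of `x² = 1`, but
a cyclic group has at most two (Mathlib `IsCyclic.card_pow_eq_one_le`). [folklore] -/
theorem paneKlein_not_isCyclic [FiniteDimensional F L] {t₀ s₀ : L ≃ₐ[F] L} (ht : t₀ ≠ 1)
    (hs : s₀ ≠ 1) (hst : s₀ ≠ t₀) (htt : t₀ * t₀ = 1) (hss : s₀ * s₀ = 1) :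
    ¬ IsCyclic (L ≃ₐ[F] L) := by
  classical
  intro hcyc
  have hle := IsCyclic.card_pow_eq_one_le (α := L ≃ₐ[F] L) (n := 2) two_pos
  have h3 : ({1, t₀, s₀} : Finset (L ≃ₐ[F] L)) ⊆
      Finset.univ.filter fun a : L ≃ₐ[F] L ↦ a ^ 2 = 1 := by
    intro a ha
    simp only [Finset.mem_insert, Finset.mem_singleton] at ha
    simp only [Finset.mem_filter, Finset.mem_univ, true_and]
    rcases ha with rfl | rfl | rfl
    · exact one_pow 2
    · rw [sq, htt]
    · rw [sq, hss]
  have hcard3 : ({1, t₀, s₀} : Finset (L ≃ₐ[F] L)).card = 3 := by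
    rw [Finset.card_insert_of_notMem, Finset.card_insert_of_notMem, Finset.card_singleton]
    · simpa using hst.symm
    · simp only [Finset.mem_insert, Finset.mem_singleton, not_or]
      exact ⟨ht.symm, hs.symm⟩
  have := Finset.card_le_card h3
  omega

variable [NumberField F] [NumberField L]

-- adapted from work/stubs/AsaiTowerPlaces.lean (`inertiaDeg_ne_finrank_of_not_isCyclic`), itself adapted from
-- Literature/NumberTheory/Automorphic/AutomorphicInductionUnitaryCharacterCubicResolventDescent.lean
/-- **At a place unramified in a Galois extension with NON-CYCLIC group, no place has full residue
degree `[L:F]`**: otherwise its decomposition group is all of `Gal(L/F)`, which embeds (inertia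
being trivial, Mathlib `Ideal.Quotient.ker_stabilizerHom`, `Ideal.card_inertia_eq_ramificationIdxIn`)
into the automorphism group of the residue field extension, a cyclic group. [folklore] -/
theorem paneKlein_inertiaDeg_ne_finrank [IsGalois F L] (hG : ¬ IsCyclic (L ≃ₐ[F] L))
    {v : HeightOneSpectrum (𝓞 F)} {W : HeightOneSpectrum (𝓞 L)}
    (hW : W.asIdeal.under (𝓞 F) = v.asIdeal) (hv : Algebra.IsUnramifiedIn (𝓞 L) v.asIdeal) :
    W.asIdeal.inertiaDeg (𝓞 F) ≠ Module.finrank F L := by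
  intro heq
  haveI : Module.Finite (𝓞 F) (𝓞 L) := IsIntegralClosure.finite (𝓞 F) F L (𝓞 L)
  haveI : IsGaloisGroup (L ≃ₐ[F] L) (𝓞 F) (𝓞 L) := IsGaloisGroup.of_isFractionRing _ _ _ F L
  haveI := W.isPrime
  haveI := v.isPrime
  haveI := W.isMaximal
  haveI := v.isMaximal
  haveI : W.asIdeal.LiesOver v.asIdeal := ⟨hW.symm⟩
  -- the decomposition group is everything
  have htop : MulAction.stabilizer (L ≃ₐ[F] L) W.asIdeal = ⊤ := by
    rw [← HeightOneSpectrum.stabilizer_eq_stabilizer_asIdeal]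
    refine Subgroup.eq_top_of_card_eq _ ?_
    rw [HeightOneSpectrum.card_stabilizer_eq_inertiaDeg hW hv, heq, IsGalois.card_aut_eq_finrank]
  -- the action on the residue field is faithful (inertia is trivial)
  set φ := Ideal.Quotient.stabilizerHom W.asIdeal v.asIdeal (L ≃ₐ[F] L) with hφ
  have hinj : Function.Injective φ := by
    rw [← MonoidHom.ker_eq_bot_iff]
    refine Subgroup.eq_bot_of_card_eq _ ?_
    rw [← Subgroup.card_subtype _ φ.ker, hφ, Ideal.Quotient.map_ker_stabilizer_subtype,
      Ideal.card_inertia_eq_ramificationIdxIn (G := L ≃ₐ[F] L) v.asIdeal W.asIdeal,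
      Ideal.ramificationIdxIn_eq_ramificationIdx v.asIdeal W.asIdeal (L ≃ₐ[F] L),
      hv.ramificationIdx_eq_one ⟨hW.symm⟩]
  -- the automorphism group of the residue extension is cyclic, hence so is the stabiliser, hence `G`
  letI := Ideal.Quotient.field W.asIdeal
  letI := Ideal.Quotient.field v.asIdeal
  haveI : Finite (𝓞 L ⧸ W.asIdeal) := Ideal.finiteQuotientOfFreeOfNeBot W.asIdeal W.ne_bot
  haveI : IsCyclic (MulAction.stabilizer (L ≃ₐ[F] L) W.asIdeal) :=
    isCyclic_of_surjective (MonoidHom.ofInjective hinj).symm.toMonoidHom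
      (MonoidHom.ofInjective hinj).symm.surjective
  have hsurj : Function.Surjective (MulAction.stabilizer (L ≃ₐ[F] L) W.asIdeal).subtype := by
    intro g
    exact ⟨⟨g, htop ▸ Subgroup.mem_top g⟩, rfl⟩
  exact hG (isCyclic_of_surjective _ hsurj)

end Klein

/-! ## §2 The pane automorphisms -/

section Pane

open Literature.NumberTheory.QuadraticForms

variable {F₀ F K L F' : Type} [Field F₀] [NumberField F₀] [Field F] [NumberField F]
  [Field K] [NumberField K] [Field L] [NumberField L] [Field F'] [NumberField F']
  [Algebra F₀ F] [Algebra F₀ K] [Algebra F₀ L] [Algebra F L] [Algebra K L] [Algebra F' L]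
  [IsScalarTower F₀ F L] [IsScalarTower F₀ K L]

omit [NumberField F₀] [NumberField F] [NumberField K] [NumberField L] [NumberField F']
  [IsScalarTower F₀ F L] [IsScalarTower F₀ K L] in
/-- **`(σ • 𝔓) ∩ 𝓞 F = ρ • (𝔓 ∩ 𝓞 F)` when `σ|_F = ρ`**: an automorphism of `L` restricting to `ρ` on
`F` moves the place below as `ρ` does (for automorphisms over arbitrary, possibly different, base
fields `A ⊆ L`, `B ⊆ F`). [folklore] -/
theorem under_smul_of_comm {A B : Type} [Field A] [Field B] [Algebra A L] [Algebra B F]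
    {σ : L ≃ₐ[A] L} {ρ : F ≃ₐ[B] F}
    (hσ : ∀ x : F, σ (algebraMap F L x) = algebraMap F L (ρ x)) (w : HeightOneSpectrum (𝓞 L)) :
    (σ • w).under (𝓞 F) = ρ • w.under (𝓞 F) := by
  -- adapted from work/stubs/AsaiTowerPlaces.lean (`under_smul_of_restricts`)
  have hσ' : ∀ x : F, σ⁻¹ (algebraMap F L x) = algebraMap F L (ρ⁻¹ x) := fun x ↦ by
    rw [AlgEquiv.aut_inv, AlgEquiv.aut_inv, AlgEquiv.symm_apply_eq, hσ, AlgEquiv.apply_symm_apply]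
  have h2 : ∀ x : 𝓞 F, σ⁻¹ • algebraMap (𝓞 F) (𝓞 L) x = algebraMap (𝓞 F) (𝓞 L) (ρ⁻¹ • x) := by
    intro x
    apply RingOfIntegers.ext
    rw [RingOfIntegers.coe_algEquiv_smul]
    change σ⁻¹ (algebraMap F L (x : F)) = algebraMap F L ((ρ⁻¹ • x : 𝓞 F) : F)
    rw [hσ', RingOfIntegers.coe_algEquiv_smul]
  apply HeightOneSpectrum.ext
  ext x
  rw [HeightOneSpectrum.under_asIdeal, Ideal.under, Ideal.mem_comap, HeightOneSpectrum.smul_asIdeal,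
    HeightOneSpectrum.smul_asIdeal, HeightOneSpectrum.under_asIdeal]
  constructor
  · intro hx
    have h1 : σ⁻¹ • algebraMap (𝓞 F) (𝓞 L) x ∈ w.asIdeal := by
      have := (HeightOneSpectrum.smul_mem_smul_asIdeal_iff σ w (σ⁻¹ • algebraMap (𝓞 F) (𝓞 L) x)).mp
      rw [smul_inv_smul] at this
      exact this hx
    rw [h2] at h1
    have h3 : ρ⁻¹ • x ∈ (w.under (𝓞 F)).asIdeal := h1
    have := (HeightOneSpectrum.smul_mem_smul_asIdeal_iff ρ (w.under (𝓞 F)) (ρ⁻¹ • x)).mpr h3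
    rwa [smul_inv_smul] at this
  · intro hx
    have h3 : ρ⁻¹ • x ∈ (w.under (𝓞 F)).asIdeal := by
      have := (HeightOneSpectrum.smul_mem_smul_asIdeal_iff ρ (w.under (𝓞 F)) (ρ⁻¹ • x)).mp
      rw [smul_inv_smul] at this
      exact this hx
    have h1 : algebraMap (𝓞 F) (𝓞 L) (ρ⁻¹ • x) ∈ w.asIdeal := h3
    rw [← h2] at h1
    have := (HeightOneSpectrum.smul_mem_smul_asIdeal_iff σ w (σ⁻¹ • algebraMap (𝓞 F) (𝓞 L) x)).mpr h1
    rwa [smul_inv_smul] at this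

omit [NumberField F] [NumberField K] [NumberField F'] [Algebra F₀ K] [Algebra F L] [Algebra K L]
  [Algebra F' L] [IsScalarTower F₀ F L] [IsScalarTower F₀ K L] in
/-- An automorphism of `L` (over any base) that fixes `F₀` pointwise moves a place of `L` to a
place over the same place of `F₀`, with the same residue degree over `F₀` (it is an
`F₀`-automorphism, `under_algEquiv_smul`, `inertiaDeg_algEquiv_smul`). [folklore] -/
theorem under_inertiaDeg_smul_of_fix {A : Type} [Field A] [Algebra A L] {σ : L ≃ₐ[A] L}
    (hσ₀ : ∀ z : F₀, σ (algebraMap F₀ L z) = algebraMap F₀ L z) (𝔓 : HeightOneSpectrum (𝓞 L)) :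
    (σ • 𝔓).under (𝓞 F₀) = 𝔓.under (𝓞 F₀) ∧
      (σ • 𝔓).asIdeal.inertiaDeg (𝓞 F₀) = 𝔓.asIdeal.inertiaDeg (𝓞 F₀) := by
  have hσ₀' : ∀ z : F₀, σ.toRingEquiv (algebraMap F₀ L z) = algebraMap F₀ L z := hσ₀
  set σ₀ : L ≃ₐ[F₀] L := AlgEquiv.ofRingEquiv hσ₀' with hσ₀def
  have h : σ • 𝔓 = σ₀ • 𝔓 := rfl
  rw [h]
  exact ⟨HeightOneSpectrum.under_algEquiv_smul F₀ L σ₀ 𝔓,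
    HeightOneSpectrum.inertiaDeg_algEquiv_smul (F := F₀) L σ₀ 𝔓⟩

omit [NumberField F₀] [NumberField F] [NumberField K] [NumberField L] [NumberField F'] [Algebra F₀ K]
  [Algebra K L] [Algebra F' L] [IsScalarTower F₀ K L] in
/-- `𝔓 ∩ 𝓞 F₀ = (𝔓 ∩ 𝓞 F) ∩ 𝓞 F₀` for the places of the tower `F₀ ⊆ F ⊆ L`
(Mathlib `Ideal.under_under`). [folklore] -/
theorem under_under_place (𝔓 : HeightOneSpectrum (𝓞 L)) :
    (𝔓.under (𝓞 F)).under (𝓞 F₀) = 𝔓.under (𝓞 F₀) := by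
  apply HeightOneSpectrum.ext
  rw [HeightOneSpectrum.under_asIdeal, HeightOneSpectrum.under_asIdeal,
    HeightOneSpectrum.under_asIdeal, Ideal.under_under]

omit [NumberField K] [NumberField F'] [Algebra F₀ K] [Algebra K L] [Algebra F' L]
  [IsScalarTower F₀ K L] in
/-- **Residue degrees over `F` are preserved by an automorphism restricting to `F`**: if `σ`
fixes `F₀` and restricts to `ρ ∈ Aut(F/F₀)` on `F`, then `f(σ𝔓 | ρw) = f(𝔓 | w)` for
`w = 𝔓 ∩ 𝓞 F` (multiplicativity `f(𝔓|v) = f(w|v) f(𝔓|w)` in `F₀ ⊆ F ⊆ L`, Mathlib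
`Ideal.inertiaDeg_tower`, and invariance over `F₀`). [folklore] -/
theorem inertiaDeg_F_smul_of_comm {A : Type} [Field A] [Algebra A L] {σ : L ≃ₐ[A] L}
    (hσ₀ : ∀ z : F₀, σ (algebraMap F₀ L z) = algebraMap F₀ L z) {ρ : F ≃ₐ[F₀] F}
    (hσ : ∀ x : F, σ (algebraMap F L x) = algebraMap F L (ρ x)) (𝔓 : HeightOneSpectrum (𝓞 L)) :
    (σ • 𝔓).asIdeal.inertiaDeg (𝓞 F) = 𝔓.asIdeal.inertiaDeg (𝓞 F) := by
  have h1 := (under_inertiaDeg_smul_of_fix (F₀ := F₀) hσ₀ 𝔓).2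
  have hw : (σ • 𝔓).under (𝓞 F) = ρ • 𝔓.under (𝓞 F) := under_smul_of_comm hσ 𝔓
  have key : ∀ 𝔔 : HeightOneSpectrum (𝓞 L), 𝔔.asIdeal.inertiaDeg (𝓞 F₀) =
      (𝔔.under (𝓞 F)).asIdeal.inertiaDeg (𝓞 F₀) * 𝔔.asIdeal.inertiaDeg (𝓞 F) := fun 𝔔 ↦ by
    haveI : 𝔔.asIdeal.LiesOver (𝔔.under (𝓞 F)).asIdeal := ⟨rfl⟩
    exact Ideal.inertiaDeg_tower (𝔔.under (𝓞 F)).asIdeal 𝔔.asIdeal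
  have h2 := key (σ • 𝔓)
  rw [h1, key 𝔓, hw, HeightOneSpectrum.inertiaDeg_algEquiv_smul] at h2
  haveI := (𝔓.under (𝓞 F)).isMaximal
  exact (Nat.eq_of_mul_eq_mul_left (Ideal.inertiaDeg_pos (𝔓.under (𝓞 F)).asIdeal (𝓞 F₀)) h2).symm

/-- **The pane automorphisms.**  In the pane tower (`[F:F₀] = [K:F₀] = 2` with involutions
`τ, cK ≠ 1`, `IsPaneTower τ cK L F' s`): the generator `t` of `Gal(L/K)` restricts to `τ` on
`F` (an element of `F` fixed by `t` lies in `K`, `exists_algebraMap_eq_of_fixed`, hence in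
`F ∩ K = F₀`; so `t|_F ≠ 1` and `t|_F = τ`, `AlgEquiv.restrictNormal`), and above every place of
`F₀` unramified in `L` no place of `L` has residue degree `4` (`Gal(L/F₀) = {1, t₀, s₀, s₀t₀}` is
a non-cyclic group of order `4 = [L:F₀]`, §1). [folklore] -/
theorem exists_paneGen (hdeg : Module.finrank F₀ F = 2) {τ : F ≃ₐ[F₀] F} (hτ : τ ≠ 1)
    (h2K : Module.finrank F₀ K = 2) {cK : K ≃ₐ[F₀] K} (hcK : cK ≠ 1) {s : L ≃ₐ[F'] L}
    (hT : IsPaneTower τ cK L F' s) :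
    ∃ t : L ≃ₐ[K] L, t ≠ 1 ∧ (∀ x : F, t (algebraMap F L x) = algebraMap F L (τ x)) ∧
      ∀ 𝔓 : HeightOneSpectrum (𝓞 L),
        Algebra.IsUnramifiedIn (𝓞 L) (𝔓.under (𝓞 F₀)).asIdeal →
          𝔓.asIdeal.inertiaDeg (𝓞 F₀) ≠ 4 := by
  obtain ⟨hFL, hKL, hF'L, hs1, hsK, hsF, hdisj, -⟩ := hT
  haveI : Algebra.IsQuadraticExtension K L := ⟨hKL⟩
  haveI : Algebra.IsQuadraticExtension F' L := ⟨hF'L⟩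
  haveI : Algebra.IsQuadraticExtension F₀ F := ⟨hdeg⟩
  haveI : IsGalois F₀ F := Algebra.IsQuadraticExtension.isGalois F₀ F
  obtain ⟨t, ht⟩ := QuadraticExtension.exists_algEquiv_ne_one (K := K) (E := L)
  -- `s` as an `F₀`-automorphism
  have hsF₀ : ∀ z : F₀, s.toRingEquiv (algebraMap F₀ L z) = algebraMap F₀ L z := fun z ↦ by
    change s (algebraMap F₀ L z) = algebraMap F₀ L z
    rw [IsScalarTower.algebraMap_apply F₀ K L, hsK, AlgEquiv.commutes]
  set s₀ : L ≃ₐ[F₀] L := AlgEquiv.ofRingEquiv hsF₀ with hs₀def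
  have hs₀ : ∀ x, s₀ x = s x := fun _ ↦ rfl
  set t₀ : L ≃ₐ[F₀] L := t.restrictScalars F₀ with ht₀def
  have ht₀ : ∀ x, t₀ x = t x := fun _ ↦ rfl
  -- an element of `K` moved by `cK`
  obtain ⟨y, hy⟩ : ∃ y : K, cK y ≠ y := by
    by_contra h
    push Not at h
    exact hcK (AlgEquiv.ext h)
  have hinjK := (algebraMap K L).injective
  have hne1 : t₀ ≠ 1 := fun h ↦ ht (AlgEquiv.ext fun x ↦ by
    have := AlgEquiv.congr_fun h x
    rw [ht₀, AlgEquiv.one_apply] at this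
    rw [this, AlgEquiv.one_apply])
  have hne2 : s₀ ≠ 1 := fun h ↦ hs1 (AlgEquiv.ext fun x ↦ by
    have := AlgEquiv.congr_fun h x
    rw [hs₀, AlgEquiv.one_apply] at this
    rw [this, AlgEquiv.one_apply])
  have hne3 : s₀ ≠ t₀ := by
    intro h
    have := congrArg (fun g : L ≃ₐ[F₀] L ↦ g (algebraMap K L y)) h
    simp only [hs₀, ht₀, hsK, AlgEquiv.commutes] at this
    exact hy (hinjK this)
  have hne4 : s₀ * t₀ ≠ 1 := by
    intro h
    have := congrArg (fun g : L ≃ₐ[F₀] L ↦ g (algebraMap K L y)) h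
    simp only [AlgEquiv.mul_apply, AlgEquiv.one_apply, hs₀, ht₀, hsK, AlgEquiv.commutes] at this
    exact hy (hinjK this)
  have htt : t₀ * t₀ = 1 := AlgEquiv.ext fun x ↦ by
    have := congrArg (fun g : L ≃ₐ[K] L ↦ g x) (QuadraticExtension.algEquiv_mul_self ht)
    simpa only [AlgEquiv.mul_apply, AlgEquiv.one_apply, ht₀] using this
  have hss : s₀ * s₀ = 1 := AlgEquiv.ext fun x ↦ by
    have := congrArg (fun g : L ≃ₐ[F'] L ↦ g x) (QuadraticExtension.algEquiv_mul_self hs1)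
    simpa only [AlgEquiv.mul_apply, AlgEquiv.one_apply, hs₀] using this
  have h4 : Module.finrank F₀ L = 4 := by
    rw [← Module.finrank_mul_finrank F₀ K L, h2K, hKL]
  -- `t` acts on `F` by `τ`
  have htF : ∀ x : F, t (algebraMap F L x) = algebraMap F L (τ x) := by
    set τ' : F ≃ₐ[F₀] F := t₀.restrictNormal F with hτ'def
    have hτ' : ∀ x : F, algebraMap F L (τ' x) = t (algebraMap F L x) := fun x ↦
      AlgEquiv.restrictNormal_commutes t₀ F x
    rcases QuadraticExtension.algEquiv_eq_one_or_eq hτ τ' with h | h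
    · exfalso
      obtain ⟨x, hx⟩ : ∃ x : F, τ x ≠ x := by
        by_contra h'
        push Not at h'
        exact hτ (AlgEquiv.ext h')
      have hfix : t (algebraMap F L x) = algebraMap F L x := by rw [← hτ', h, AlgEquiv.one_apply]
      obtain ⟨r, hr⟩ := QuadraticExtension.exists_algebraMap_eq_of_fixed ht hfix
      obtain ⟨z, rfl⟩ := hdisj x r hr.symm
      exact hx (AlgEquiv.commutes τ z)
    · intro x
      rw [← hτ', h]
  refine ⟨t, ht, htF, fun 𝔓 hv ↦ ?_⟩
  haveI := paneKlein_isGalois h4 hne1 hne2 hne3 hne4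
  haveI : FiniteDimensional F₀ L := Module.finite_of_finrank_eq_succ h4
  rw [← h4]
  exact paneKlein_inertiaDeg_ne_finrank (paneKlein_not_isCyclic hne1 hne2 hne3 htt hss) rfl hv

/-! ## §3 Residue degrees in the pane tower -/

omit [NumberField K] [Algebra F₀ K] [IsScalarTower F₀ K L] in
/-- **A `t`-fixed place of `L` above an unramified place splits over `F`.**  If `t • 𝔓 = 𝔓` for the
generator `t` of `Gal(L/K)` (acting by `τ` on `F`) then `τ` fixes `w = 𝔓 ∩ 𝓞 F`, so `f(w|v) = 2`
(`v = 𝔓 ∩ 𝓞 F₀` unramified in `F`), and `f(𝔓|w) = 2` would give `f(𝔓|v) = 4`; hence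
`f(𝔓|w) = 1`. [folklore] -/
theorem pane_inertiaDeg_F_eq_one (hdeg : Module.finrank F₀ F = 2) {τ : F ≃ₐ[F₀] F} (hτ : τ ≠ 1)
    (hFL : Module.finrank F L = 2) {t : L ≃ₐ[K] L}
    (htF : ∀ x : F, t (algebraMap F L x) = algebraMap F L (τ x))
    (h4 : ∀ 𝔓 : HeightOneSpectrum (𝓞 L), Algebra.IsUnramifiedIn (𝓞 L) (𝔓.under (𝓞 F₀)).asIdeal →
      𝔓.asIdeal.inertiaDeg (𝓞 F₀) ≠ 4)
    {𝔓 : HeightOneSpectrum (𝓞 L)} (ht𝔓 : t • 𝔓 = 𝔓)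
    (hvL : Algebra.IsUnramifiedIn (𝓞 L) (𝔓.under (𝓞 F₀)).asIdeal)
    (hvF : Algebra.IsUnramifiedIn (𝓞 F) (𝔓.under (𝓞 F₀)).asIdeal) :
    τ • 𝔓.under (𝓞 F) = 𝔓.under (𝓞 F) ∧ (𝔓.under (𝓞 F)).asIdeal.inertiaDeg (𝓞 F₀) = 2 ∧
      𝔓.asIdeal.inertiaDeg (𝓞 F) = 1 := by
  haveI : Algebra.IsQuadraticExtension F L := ⟨hFL⟩
  haveI : IsGalois F L := Algebra.IsQuadraticExtension.isGalois F L
  have hτw : τ • 𝔓.under (𝓞 F) = 𝔓.under (𝓞 F) := by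
    rw [← under_smul_of_comm htF 𝔓, ht𝔓]
  have hunder : (𝔓.under (𝓞 F)).under (𝓞 F₀) = 𝔓.under (𝓞 F₀) := under_under_place 𝔓
  have hf2 : (𝔓.under (𝓞 F)).asIdeal.inertiaDeg (𝓞 F₀) = 2 :=
    inertiaDeg_eq_two_of_smul_eq_of_isUnramifiedIn hdeg hτ hτw (by rw [hunder]; exact hvF)
  refine ⟨hτw, hf2, ?_⟩
  haveI : 𝔓.asIdeal.LiesOver (𝔓.under (𝓞 F)).asIdeal := ⟨rfl⟩
  haveI : (𝔓.under (𝓞 F)).asIdeal.LiesOver (𝔓.under (𝓞 F₀)).asIdeal :=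
    ⟨by rw [← hunder]; rfl⟩
  have htower : 𝔓.asIdeal.inertiaDeg (𝓞 F₀) =
      (𝔓.under (𝓞 F)).asIdeal.inertiaDeg (𝓞 F₀) * 𝔓.asIdeal.inertiaDeg (𝓞 F) :=
    Ideal.inertiaDeg_tower (𝔓.under (𝓞 F)).asIdeal 𝔓.asIdeal
  rcases inertiaDeg_eq_one_or_two hFL 𝔓 with h | h
  · exact h
  · exfalso
    refine h4 𝔓 hvL ?_
    rw [htower, hf2, h]

end Pane

/-- **Registered anchor** of this helper file (stub registry of stmt-Langlands-10902, line
`one-transparent-pane`, helper "Klein" for `stub_memberSatake`): four pairwise distinct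
automorphisms of a degree-`4` extension make it Galois. [folklore] -/
theorem memberSatakeKlein_anchor : ∀ (F L : Type) [Field F] [Field L] [Algebra F L] (t₀ s₀ : L ≃ₐ[F] L), Module.finrank F L = 4 → t₀ ≠ 1 → s₀ ≠ 1 → s₀ ≠ t₀ → s₀ * t₀ ≠ 1 → IsGalois F L :=
  fun _ _ _ _ _ _ _ h4 ht hs hst hst1 ↦ paneKlein_isGalois h4 ht hs hst hst1

end Summit.Langlands.Langlands.Theorems.HostInducedRep.OneTransparentPane

end
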